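import Summits.ResolutionOfSingularities.ResolutionOfSingularities.Theorems.HilbertSamuelEliminationSigmaMaxModificationsCorridor3WLadderIsoTailsFreeRationalHyp
import HarnessLib

/-!
# [OURS · L1 W4.2] D14 ROUTE H — **H∞-FINAL WITHOUT THE GRADE**: the K1 hypersurface cell for point towers of ANY directrix grade
# `ē ≥ 1` (crux `SigmaMaxModifications` stmt-ResolutionOfSingularities-18506 / conjunct stmt-…-19249; line `w_ladder`; row
# `stub_Wlow3M_two` (β), the `e = 1` third door; `--supports stmt-…-19249`, helper)

Stub worker res-L1-w42-stub-3 (gen 5). Sorry-free PROOF file, no definition, no named fact. OURS (cell res-hironaka, slot W4.2);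
NOT statements of [Hironaka2017] nor of [CossartJannsenSaito2020] / [CossartPiltant2009]. AI-written; AI review is weaker than
expert review.

res-type-001's H∞-FINAL `IsoTailsHS.false_of_isIsoPointTower_of_freeRationalTail_of_hypersurfaceStage` (p532642) is stated for
`IsIsoPointTower 3 ν T pt`, whose LAST conjunct is the W-top grade `∀ n, 3 ≤ ē_{x_n}` (…MovingIsoDefs :126). Its mechanism (frame tower
of a free-rational tail ⇒ osculating arc inside the Hilbert–Samuel stratum of `Spec 𝒪̂_{X_{n₀},x_{n₀}}` ⇒ contradiction with isolation)
never reads that grade except through `IsIsoPointTower.isMaximalOrigin`, where `3 ≤ ē` only serves `1 ≤ ē` (the marked closed point is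
not a minimal prime, so it is a permissible centre, CJS Def. 3.1 (2)) — res-L1-w42-stub-4 PLANNING NOTE 2026-08-27T13:06:39Z. This file
RE-RUNS the same proof on an UNBUNDLED point tower `(hC, hπ, hcl, hν)` with the grade weakened to `∀ n, 1 ≤ ē_{x_n}` and the
isolation hypothesis read at the ONE stage `n₀` where it is used — so that the `e = 1` door of the W-low rows (`e = 1 ≤ ē ≤ 2`: CJS
Cor. 6.37's infinite fundamental sequence over an isolated point is a free-rational point tower) can dock at the same cell.
res-type-001's file is not touched; every lemma of the chain (H1 `hilbertSamuelFun_stalk_eq_of_tower`, H8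
`isIsolatedInHSMaxLocus_adicCompletion_of_ringEquiv`, H7∞ `not_isIsolatedInHSMaxLocus_adicCompletion_of_frameTowerArc`, G1a-2
`FormalFrame.exists_frameTower_arc_of_charP`) is consumed BY NAME.

## What is proved

* `IsoTailsHS.isMaximalOrigin_of_pointTower` — every stage of a point tower (`C_n = {x_n}`, `π_n x_{n+1} = x_n`, `x_n` closed,
  `H^N(x_n) = ν`, `1 ≤ ē_{x_n}`) over a maximal origin is a maximal origin (`IsMaximalOrigin.of_isBlowup_singleton_of_le_geomDirDim`).
* `IsoTailsHS.isIsolatedInHSMaxLocus_spec_stalk_of_pointTower` — isolation of `x_n` in `(X_n)_max` passes to the closed point of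
  `Spec 𝒪_{X_n,x_n}` (upper semicontinuity over the field of the origin + res-type-053's `BlowupTower.isIsolatedInHSMaxLocus_localize`).
* `IsoTailsHS.false_of_pointTower_of_hypersurfaceStage_of_arc` — H∞ (binder form) for such a tower, isolation at `n₀` only.
* **`IsoTailsHS.false_of_pointTower_of_freeRationalTail_of_hypersurfaceStage`** — THE K1 HYPERSURFACE CELL AT EVERY GRADE `ē ≥ 1`:
  a point tower over a maximal origin of characteristic `p` whose stage `n₀` is ISOLATED in `(X_{n₀})_max` and a hypersurface
  singularity of embedding dimension `4` (presentation adapted to the tail) has no free-rational tail from `n₀` on.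
(The graded H∞-FINAL is the specialisation `3 ≤ ē ⇒ 1 ≤ ē`, isolation at `n₀` read off the tower datum — not restated, dedup.)

[OURS · L1 W4.2; AI-written]
-/

set_option linter.dupNamespace false

noncomputable section

open CategoryTheory AlgebraicGeometry TopologicalSpace IsLocalRing MvPowerSeries
open Literature.AlgebraicGeometry.Resolution Literature.RingTheory.HilbertSamuel
open Literature.AlgebraicGeometry.CossartJannsenSaito2020
open Summit.ResolutionOfSingularities.ResolutionOfSingularities.Theorems.CampaignW42
open Summit.ResolutionOfSingularities.ResolutionOfSingularities.Theorems.SigmaMaxModificationsCorridor3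
open Summit.ResolutionOfSingularities.ResolutionOfSingularities.Cruxes.SigmaMaxModifications
open Summit.ResolutionOfSingularities.ResolutionOfSingularities.Cruxes.SigmaMaxModifications.IdeasL1C4
open Summit.ResolutionOfSingularities.ResolutionOfSingularities.Cruxes.SigmaMaxModifications.IdeasL1Idea2R4

namespace Summit.ResolutionOfSingularities.ResolutionOfSingularities.Theorems.SigmaMaxModificationsCorridor3.IsoTailsHS

universe u

section PointTower

variable {p N : ℕ} {ν : ℕ → ℕ} {T : BlowupTower.{u}} {pt : ∀ n, T.X n}
  (hC : ∀ n, T.C n = {pt n}) (hπ : ∀ n, (T.π n).base (pt (n + 1)) = pt n)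
  (hcl : ∀ n, IsClosed ({pt n} : Set (T.X n)))

include hC hcl in
/-- Along a point tower the `n`-th blow-down map is the blow-up of the marked closed point (reduced structure).
[cite: CossartJannsenSaito2020, Def. 6.34] -/
theorem isBlowup_singleton_of_pointTower (n : ℕ) :
    IsBlowup (T.π n) (Scheme.IdealSheafData.vanishingIdeal ⟨{pt n}, hcl n⟩) := by
  have h : (⟨T.C n, T.isClosed_C n⟩ : Closeds (T.X n)) = ⟨{pt n}, hcl n⟩ := Closeds.ext (hC n)
  rw [← h]
  exact T.isBlowup n

include hC hcl in
/-- **Every stage of a point tower of grade `ē ≥ 1` over a maximal origin is a maximal origin** for the same `(p, N, ν)`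
(res-type-012's `IsIsoPointTower.isMaximalOrigin` with `3 ≤ ē` weakened to `1 ≤ ē`, which is all that
`IsMaximalOrigin.of_isBlowup_singleton_of_le_geomDirDim` consumes). [cite: CossartJannsenSaito2020, Def. 3.1 (2), Cor. 3.12] -/
theorem isMaximalOrigin_of_pointTower (hν : ∀ n, Scheme.hsFun (T.X n) N (pt n) = ν)
    (he : ∀ n, 1 ≤ @Scheme.geomDirDim (T.X n) (T.ln n) (pt n)) (h0 : IsMaximalOrigin p N ν (T.X 0) (pt 0)) (n : ℕ) :
    IsMaximalOrigin p N ν (T.X n) (pt n) := by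
  induction n with
  | zero => exact h0
  | succ n ih =>
    haveI : IsLocallyNoetherian (T.X n) := T.ln n
    exact ih.of_isBlowup_singleton_of_le_geomDirDim (hcl n) (he n) (isBlowup_singleton_of_pointTower hC hcl n)
      (hcl (n + 1)) (hν (n + 1))

include hC hcl in
/-- **Isolation in `Spec 𝒪_{X_n,x_n}`** at ONE stage `n` of a point tower of grade `ē ≥ 1` over a maximal origin: the stage is a
maximal origin, so of finite type over a field, `H^N` is upper semicontinuous along generizations
(`Scheme.hsFun_le_hsFun_of_specializes_over_field`), and isolation of `x_n` in `(X_n)_max` passes to the closed point of the local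
scheme (res-type-053's `BlowupTower.isIsolatedInHSMaxLocus_localize` on the constant tower). [cite: CossartJannsenSaito2020, Def. 13.3, Thm. 2.33 (1)] -/
theorem isIsolatedInHSMaxLocus_spec_stalk_of_pointTower (hν : ∀ n, Scheme.hsFun (T.X n) N (pt n) = ν)
    (he : ∀ n, 1 ≤ @Scheme.geomDirDim (T.X n) (T.ln n) (pt n)) (h0 : IsMaximalOrigin p N ν (T.X 0) (pt 0)) (n : ℕ)
    (hiso : @IsIsolatedInHSMaxLocus (T.X n) (T.ln n) N (pt n)) :
    @IsIsolatedInHSMaxLocus (Spec ((T.X n).presheaf.stalk (pt n)))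
      (by haveI : IsLocallyNoetherian (T.X n) := T.ln n; exact inferInstance) N
      (closedPoint ((T.X n).presheaf.stalk (pt n))) := by
  haveI : IsLocallyNoetherian (T.X n) := T.ln n
  have hOn : IsMaximalOrigin p N ν (T.X n) (pt n) := isMaximalOrigin_of_pointTower hC hcl hν he h0 n
  obtain ⟨k, _, _, f, -, hft, -⟩ := hOn.exists_structure
  haveI := hft
  have hsc : ∀ y : T.X n, y ⤳ pt n → Scheme.hsFun (T.X n) N y ≤ Scheme.hsFun (T.X n) N (pt n) :=
    fun y hy => Scheme.hsFun_le_hsFun_of_specializes_over_field f N hy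
  let T₀ : BlowupTower.{u} :=
    { X := fun _ => T.X n, ln := fun _ => T.ln n, C := fun _ => ∅, isClosed_C := fun _ => isClosed_empty,
      π := fun _ => 𝟙 (T.X n), isBlowup := fun _ => Moving.isBlowup_id_vanishingIdeal_empty (T.X n) }
  exact T₀.isIsolatedInHSMaxLocus_localize (pt n) N hsc hiso

include hC hcl in
/-- **H∞ (binder form) WITHOUT THE GRADE: no osculating arc at an ISOLATED HYPERSURFACE stage of a point tower of grade `ē ≥ 1`.**
Data: the point tower at level `3` over a maximal origin of characteristic `p`; a stage `n₀` with `x_{n₀}` isolated in `(X_{n₀})_max` and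
`𝒪_{X_{n₀},x_{n₀}} ≅ R/(h)`, `R` regular local of embedding dimension `4`, `h ∉ 𝔪^{m+1}`; Cohen coordinates `Ψ`, base frame `ψ₀` and
constants `c` with `ψ₀ h ∈ (X 1 − tSeries c₁, X 2 − tSeries c₂, X 3 − tSeries c₃)^m`. Conclusion: `False` (H8 + H7∞, as in res-type-001's
`false_of_isIsoPointTower_of_hypersurfaceStage_of_arc`). [cite: CossartJannsenSaito2020, Def. 13.3] [cite: CossartPiltant2009, ch. 3 I.9] -/
theorem false_of_pointTower_of_hypersurfaceStage_of_arc (hν : ∀ n, Scheme.hsFun (T.X n) 3 (pt n) = ν)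
    (he : ∀ n, 1 ≤ @Scheme.geomDirDim (T.X n) (T.ln n) (pt n)) (h0 : IsMaximalOrigin p 3 ν (T.X 0) (pt 0)) (n₀ : ℕ)
    (hiso : @IsIsolatedInHSMaxLocus (T.X n₀) (T.ln n₀) 3 (pt n₀))
    {R : Type u} [CommRing R] [IsRegularLocalRing R] (hd : (maximalIdeal R).spanFinrank = 4)
    (σ : R →+* (T.X n₀).presheaf.stalk (pt n₀)) (hσ : Function.Surjective σ) {h : R}
    (hker : RingHom.ker σ = Ideal.span {h}) {m : ℕ} (hh : h ∉ maximalIdeal R ^ (m + 1))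
    {κ : Type u} [Field κ] (Ψ : MvPowerSeries (Fin 4) κ ≃+* AdicCompletion (maximalIdeal R) R)
    (ψ₀ : R →+* MvPowerSeries (Fin 4) κ) (hψ₀ : ∀ r, Ψ (ψ₀ r) = algebraMap R (AdicCompletion (maximalIdeal R) R) r)
    (c : ℕ → Fin 4 → κ)
    (hhP : ψ₀ h ∈ (Ideal.span ({X 1 - IdeasL1C5.Series.tSeries (fun k => c k 1), X 2 - IdeasL1C5.Series.tSeries (fun k => c k 2),
      X 3 - IdeasL1C5.Series.tSeries (fun k => c k 3)} : Set (MvPowerSeries (Fin 4) κ))) ^ m) :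
    False := by
  haveI : IsLocallyNoetherian (T.X n₀) := T.ln n₀
  have hexc : Scheme.IsExcellent (T.X n₀) := isExcellent_X T (isExcellent_of_isMaximalOrigin h0) n₀
  have hA : IsExcellentRing ((T.X n₀).presheaf.stalk (pt n₀)) := isExcellentRing_stalk_of_isExcellent hexc (pt n₀)
  have hdim : ringKrullDim ((T.X n₀).presheaf.stalk (pt n₀)) ≤ ((3 : ℕ) : WithBot ℕ∞) :=
    ringKrullDim_stalk_le T h0.dim_le n₀ (pt n₀)
  have hm : 1 ≤ m := one_le_of_presentation σ hker hh
  have hisoS := isIsolatedInHSMaxLocus_spec_stalk_of_pointTower hC hcl hν he h0 n₀ hiso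
  obtain ⟨e⟩ := nonempty_ringEquiv_quotient_span_of_surjective σ hσ hker
  have hisoC := isIsolatedInHSMaxLocus_adicCompletion_of_ringEquiv ((T.X n₀).presheaf.stalk (pt n₀)) hA
    (Ideal.span {h}) e 3 hdim hisoS
  exact not_isIsolatedInHSMaxLocus_adicCompletion_of_frameTowerArc hd σ hσ hker hm hh Ψ ψ₀ hψ₀ c hhP (le_refl 3) hisoC

include hC hπ hcl in
/-- **K1 AT AN ISOLATED HYPERSURFACE STAGE, EVERY GRADE `ē ≥ 1`: a point tower over a maximal origin of characteristic `p` has NO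
free-rational tail starting at a stage `n₀` where `x_{n₀}` is isolated in `(X_{n₀})_max` and `𝒪_{X_{n₀},x_{n₀}}` is a hypersurface
singularity of embedding dimension `4`** (presentation `σ : R ↠ 𝒪`, `ker σ = (h)`, `h ∈ 𝔪^m ∖ 𝔪^{m+1}`, `R` regular local with
`CharP R p`, r.s.p. `x` with `x 0` the exceptional equation of the first step of the tail — res-type-071's (FREE)₀). The W-low use:
an infinite CJS fundamental sequence over an isolated point with `e = 1` (Cor. 6.37) is such a tail from `n₀ = 0` once its steps are
known to be free. Proof = res-type-001's rev-2 proof verbatim on the unbundled tower: res-D-pv-010's `FormalFrame.exists_frameTower_arc_of_charP`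
on `T.drop n₀` (with `H^{(0)}` constant by H1 `hilbertSamuelFun_stalk_eq_of_tower`), then `false_of_pointTower_of_hypersurfaceStage_of_arc`.
[cite: CossartPiltant2009, ch. 3 I.9] [cite: CossartJannsenSaito2020, Def. 13.3, Cor. 6.37] -/
theorem false_of_pointTower_of_freeRationalTail_of_hypersurfaceStage [Fact p.Prime]
    (hν : ∀ n, Scheme.hsFun (T.X n) 3 (pt n) = ν) (he : ∀ n, 1 ≤ @Scheme.geomDirDim (T.X n) (T.ln n) (pt n))
    (h0 : IsMaximalOrigin p 3 ν (T.X 0) (pt 0)) (n₀ : ℕ)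
    (hiso : @IsIsolatedInHSMaxLocus (T.X n₀) (T.ln n₀) 3 (pt n₀))
    (htail : ∀ n, n₀ ≤ n → IdeasL1C5.IsRationalStep T pt n ∧ ¬ IdeasL1C5.IsSatelliteStep T pt n)
    {R : Type u} [CommRing R] [IsRegularLocalRing R] [CharP R p] (hd : (maximalIdeal R).spanFinrank = 4)
    (x : Fin 4 → R) (hx : Ideal.span (Set.range x) = maximalIdeal R)
    (σ : R →+* (T.X n₀).presheaf.stalk (pt n₀)) (hσ : Function.Surjective σ) {h : R}
    (hker : RingHom.ker σ = Ideal.span {h}) {m : ℕ} (hm : h ∈ maximalIdeal R ^ m) (hm' : h ∉ maximalIdeal R ^ (m + 1))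
    (hfree : ∀ k, ((T.π n₀).stalkMap (pt (n₀ + 1))).hom (((T.X n₀).presheaf.stalkCongr (.of_eq (hπ n₀))).inv (σ (x 0))) ∣
      ((T.π n₀).stalkMap (pt (n₀ + 1))).hom (((T.X n₀).presheaf.stalkCongr (.of_eq (hπ n₀))).inv (σ (x k)))) :
    False := by
  have hH : ∀ n, hilbertSamuelFun (((T.drop n₀).X (n + 1)).presheaf.stalk (pt (n₀ + (n + 1)))) 0 =
      hilbertSamuelFun (((T.drop n₀).X n).presheaf.stalk (pt (n₀ + n))) 0 := fun n =>
    (hilbertSamuelFun_stalk_eq_of_tower (isExcellent_of_isMaximalOrigin h0) h0.dim_le hπ hcl hν (n₀ + (n + 1)) 0).trans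
      (hilbertSamuelFun_stalk_eq_of_tower (isExcellent_of_isMaximalOrigin h0) h0.dim_le hπ hcl hν (n₀ + n) 0).symm
  obtain ⟨Ψ, ψ₀, c, hψ₀, -, hhP⟩ :=
    IdeasL1C5.FormalFrame.exists_frameTower_arc_of_charP (T.drop n₀) (fun n => pt (n₀ + n)) (fun n => hC (n₀ + n))
      (fun n => hcl (n₀ + n)) (fun n => hπ (n₀ + n)) (fun n => (htail (n₀ + n) (Nat.le_add_right n₀ n)).1)
      (fun n => (htail (n₀ + n) (Nat.le_add_right n₀ n)).2) hH p hd x hx σ hσ hker hm hm' hfree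
  exact false_of_pointTower_of_hypersurfaceStage_of_arc hC hcl hν he h0 n₀ hiso hd σ hσ hker hm' Ψ ψ₀ hψ₀ c hhP

end PointTower

end Summit.ResolutionOfSingularities.ResolutionOfSingularities.Theorems.SigmaMaxModificationsCorridor3.IsoTailsHS

end
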